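import Summits.Schanuel.Schanuel.Theorems.ZilberEacRealLineEdgeTools
import Summits.Schanuel.Schanuel.Theorems.ZilberEacRealFibreDominance
import HarnessLib

/-!
# The equimodular class, VIII: phases of a NON-RESONANT quadratic sequence do not accumulate at a
# finite set

HONEST FRAMING.  Cell `pub-schanuel` (Zilber's Exponential-Algebraic Closedness, case ladder;
host summit Schanuel), seat 2, gen 22.  Number-theoretic input for the NON-resonant members of the
equimodular class over parabola bases (file VI/VII handle resonance by THEOREM T).  Along the
exponential points of `{x₁ = -(ix/2π)(x₀ - τ)² + κ, A(x₀)y₀ + B(x₀) = 0}` one has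
`e^{x₁} = e^{2πi(xk² + βk + γ)}·w(1/x₀)` with `β = xφ/π`, `θ = e^{τ + iφ}`; a relation `H(x₀, y₁) = 0` on
all exponential points would force the phases `e^{2πi(xk² + βk + γ)}` to accumulate at the finitely many
unimodular roots of a polynomial.  **`urot_quadratic_not_near_finset`**: if `x ∉ ℚ` or `β ∉ ℚ`, then
for every finite `F ⊆ ℂ` there is `ε > 0` such that for infinitely many `k ∈ ℕ` the phase
`urot(xk² + βk + γ)` is at distance `≥ ε` from `F`.  Proof: `x ∉ ℚ` — consecutive quotients are the
rotations `urot(2xk + x + β)`, dense on the circle (Kronecker, `exists_nat_urot_near`), while quotients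
of points near `F` stay near the finite set `F·F̄`; `x = a/b ∈ ℚ`, `β ∉ ℚ` — along `k = bℓ` the phase is
`urot(bβℓ + γ)`, dense.  [folklore] (Weyl's theorem is not needed); nothing here bears on Schanuel's
conjecture.
-/

noncomputable section

open Filter Topology Complex

set_option linter.dupNamespace false

namespace Summit.Schanuel.Schanuel.Theorems

/-! ## Part A. Small tools on the unit circle -/

/-- There is a unimodular complex number outside any finite set. [folklore] -/
theorem exists_unit_notMem_finset (G : Finset ℂ) : ∃ u : ℂ, ‖u‖ = 1 ∧ u ∉ G := by
  have hinf : (Set.range fun n : ℤ => urot (n * Real.sqrt 2)).Infinite :=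
    Set.infinite_range_of_injective (urot_int_mul_injective irrational_sqrt_two)
  obtain ⟨u, ⟨n, rfl⟩, hu⟩ := hinf.exists_notMem_finset G
  exact ⟨_, norm_urot _, hu⟩

/-- A point outside a finite set is at positive distance from it. [folklore] -/
theorem exists_pos_le_norm_sub_of_notMem {u : ℂ} {G : Finset ℂ} (hu : u ∉ G) :
    ∃ d : ℝ, 0 < d ∧ ∀ g ∈ G, d ≤ ‖u - g‖ := by
  classical
  induction G using Finset.induction_on with
  | empty => exact ⟨1, one_pos, fun g hg => absurd hg (Finset.notMem_empty g)⟩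
  | insert a s ha ih =>
    rw [Finset.mem_insert, not_or] at hu
    obtain ⟨d, hd, hds⟩ := ih hu.2
    refine ⟨min d ‖u - a‖, lt_min hd (norm_pos_iff.2 (sub_ne_zero.2 hu.1)), fun g hg => ?_⟩
    rcases Finset.mem_insert.1 hg with rfl | hg
    · exact min_le_right _ _
    · exact (min_le_left _ _).trans (hds g hg)

/-- `urot (x - y) = urot x · conj (urot y)`. [folklore] -/
theorem urot_sub_eq_mul_conj (x y : ℝ) : urot (x - y) = urot x * (starRingEnd ℂ) (urot y) := by
  have h1 : (starRingEnd ℂ) (urot y) = urot (-y) := by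
    rw [urot, urot, ← Complex.exp_conj]
    congr 1
    simp only [map_mul, Complex.conj_ofReal, map_ofNat, Complex.conj_I, Complex.ofReal_neg]
    ring
  rw [h1, ← urot_add, sub_eq_add_neg]

/-- Quotients of near points are near: `|e₁| = 1`, `‖eᵢ - ζᵢ‖ < ε ≤ 1` ⟹
`‖e₁ ē₂ - ζ₁ ζ̄₂‖ < 3ε`. [folklore] -/
theorem norm_mul_conj_sub_lt {e₁ e₂ ζ₁ ζ₂ : ℂ} (he₂ : ‖e₂‖ = 1) {ε : ℝ} (hε1 : ε ≤ 1)
    (h₁ : ‖e₁ - ζ₁‖ < ε) (h₂ : ‖e₂ - ζ₂‖ < ε) (he₁ : ‖e₁‖ = 1) :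
    ‖e₁ * (starRingEnd ℂ) e₂ - ζ₁ * (starRingEnd ℂ) ζ₂‖ < 3 * ε := by
  have hε : 0 < ε := lt_of_le_of_lt (norm_nonneg _) h₁
  have hζ₁ : ‖ζ₁‖ ≤ 1 + ε := by
    have := norm_sub_norm_le ζ₁ e₁
    rw [norm_sub_rev] at h₁
    linarith
  have e : e₁ * (starRingEnd ℂ) e₂ - ζ₁ * (starRingEnd ℂ) ζ₂ =
      (e₁ - ζ₁) * (starRingEnd ℂ) e₂ + ζ₁ * ((starRingEnd ℂ) e₂ - (starRingEnd ℂ) ζ₂) := by ring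
  rw [e]
  calc ‖(e₁ - ζ₁) * (starRingEnd ℂ) e₂ + ζ₁ * ((starRingEnd ℂ) e₂ - (starRingEnd ℂ) ζ₂)‖
      ≤ ‖(e₁ - ζ₁) * (starRingEnd ℂ) e₂‖ + ‖ζ₁ * ((starRingEnd ℂ) e₂ - (starRingEnd ℂ) ζ₂)‖ :=
        norm_add_le _ _
    _ = ‖e₁ - ζ₁‖ + ‖ζ₁‖ * ‖e₂ - ζ₂‖ := by
        rw [norm_mul, norm_mul, Complex.norm_conj, he₂, mul_one, ← map_sub, Complex.norm_conj]
    _ < ε + (1 + ε) * ε := by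
        have := mul_le_mul hζ₁ h₂.le (norm_nonneg _) (by linarith)
        linarith [mul_lt_mul_of_pos_left h₂ (show (0:ℝ) < 1 + ε by linarith)]
    _ ≤ 3 * ε := by nlinarith

/-! ## Part B. Non-resonant phases do not accumulate at a finite set -/

/-- **Case `x ∉ ℚ`.** [folklore] -/
theorem urot_quadratic_not_near_finset_of_irrational {x : ℝ} (hx : Irrational x) (β γ : ℝ)
    (F : Finset ℂ) : ∃ ε : ℝ, 0 < ε ∧ ∀ K : ℕ, ∃ k : ℕ, K ≤ k ∧
      ∀ ζ ∈ F, ε ≤ ‖urot (x * (k : ℝ) ^ 2 + β * k + γ) - ζ‖ := by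
  classical
  set G : Finset ℂ := (F ×ˢ F).image (fun p : ℂ × ℂ => p.1 * (starRingEnd ℂ) p.2) with hG
  obtain ⟨u, hu1, huG⟩ := exists_unit_notMem_finset G
  obtain ⟨d, hd, hdG⟩ := exists_pos_le_norm_sub_of_notMem huG
  refine ⟨min (d / 4) 1, lt_min (by positivity) one_pos, fun K => ?_⟩
  by_contra hcon
  push Not at hcon
  -- every `k ≥ K` has a `ζ_k ∈ F` within `ε` of the phase
  have h2x : Irrational (2 * x) := by
    have := hx.intCast_mul (m := 2) two_ne_zero; exact_mod_cast this
  -- Kronecker: `urot(2xk + x + β)` comes within `d/4` of `u`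
  set u' : ℂ := u * (starRingEnd ℂ) (urot (x + β)) with hu'
  have hu'1 : ‖u'‖ = 1 := by rw [hu', norm_mul, Complex.norm_conj, norm_urot, hu1, mul_one]
  obtain ⟨k, hkK, hk⟩ := exists_nat_urot_near h2x hu'1 (by positivity : (0:ℝ) < d / 4) K
  obtain ⟨ζ₁, hζ₁F, hζ₁⟩ := hcon (k + 1) (by omega)
  obtain ⟨ζ₀, hζ₀F, hζ₀⟩ := hcon k hkK
  have hg : ζ₁ * (starRingEnd ℂ) ζ₀ ∈ G :=
    Finset.mem_image.2 ⟨(ζ₁, ζ₀), Finset.mem_product.2 ⟨hζ₁F, hζ₀F⟩, rfl⟩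
  -- the quotient of consecutive phases is the rotation
  have hquot : urot (x * ((k + 1 : ℕ) : ℝ) ^ 2 + β * ((k + 1 : ℕ) : ℝ) + γ) *
      (starRingEnd ℂ) (urot (x * (k : ℝ) ^ 2 + β * k + γ)) = urot (k * (2 * x)) * urot (x + β) := by
    rw [← urot_sub_eq_mul_conj, ← urot_add]
    congr 1
    push_cast
    ring
  have hnear : ‖urot (k * (2 * x)) * urot (x + β) - u‖ < d / 4 := by
    have hue : u' * urot (x + β) = u := by
      rw [hu', mul_assoc, ← Complex.normSq_eq_conj_mul_self, Complex.normSq_eq_norm_sq, norm_urot]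
      simp
    have e : urot (k * (2 * x)) * urot (x + β) - u = (urot (k * (2 * x)) - u') * urot (x + β) := by
      rw [← hue]; ring
    rw [e, norm_mul, norm_urot, mul_one]
    exact hk
  have h3 : ‖urot (k * (2 * x)) * urot (x + β) - ζ₁ * (starRingEnd ℂ) ζ₀‖ < 3 * min (d / 4) 1 := by
    rw [← hquot]
    exact norm_mul_conj_sub_lt (norm_urot _) (min_le_right _ _) hζ₁ hζ₀ (norm_urot _)
  have : ‖u - ζ₁ * (starRingEnd ℂ) ζ₀‖ < d := by
    have := norm_sub_le_norm_sub_add_norm_sub u (urot (k * (2 * x)) * urot (x + β))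
      (ζ₁ * (starRingEnd ℂ) ζ₀)
    rw [norm_sub_rev] at hnear
    have h4 : 3 * min (d / 4) 1 ≤ 3 * (d / 4) := by
      exact mul_le_mul_of_nonneg_left (min_le_left _ _) (by norm_num)
    linarith
  exact absurd (hdG _ hg) (not_le.2 this)


/-- **Case `x ∈ ℚ`, `β ∉ ℚ`.** [folklore] -/
theorem urot_quadratic_not_near_finset_of_rat (q : ℚ) {β : ℝ} (hβ : Irrational β) (γ : ℝ)
    (F : Finset ℂ) : ∃ ε : ℝ, 0 < ε ∧ ∀ K : ℕ, ∃ k : ℕ, K ≤ k ∧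
      ∀ ζ ∈ F, ε ≤ ‖urot ((q : ℝ) * (k : ℝ) ^ 2 + β * k + γ) - ζ‖ := by
  classical
  obtain ⟨u, hu1, huF⟩ := exists_unit_notMem_finset F
  obtain ⟨d, hd, hdF⟩ := exists_pos_le_norm_sub_of_notMem huF
  refine ⟨d / 2, by positivity, fun K => ?_⟩
  by_contra hcon
  push Not at hcon
  set b : ℕ := q.den with hb
  have hb0 : b ≠ 0 := q.den_pos.ne'
  have hbβ : Irrational ((b : ℝ) * β) := by
    have := hβ.mul_natCast hb0; rwa [mul_comm] at this
  -- along `k = b ℓ` the phase is `urot(ℓ (bβ)) · urot γ`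
  have hphase : ∀ ℓ : ℕ, urot ((q : ℝ) * ((b * ℓ : ℕ) : ℝ) ^ 2 + β * ((b * ℓ : ℕ) : ℝ) + γ) =
      urot (ℓ * ((b : ℝ) * β)) * urot γ := by
    intro ℓ
    have hqb : (q : ℝ) * (b : ℝ) = (q.num : ℝ) := by rw [hb]; exact_mod_cast Rat.mul_den_eq_num q
    have e : (q : ℝ) * ((b * ℓ : ℕ) : ℝ) ^ 2 + β * ((b * ℓ : ℕ) : ℝ) + γ =
        (ℓ * ((b : ℝ) * β) + γ) + ((q.num * (b : ℤ) * (ℓ : ℤ) ^ 2 : ℤ) : ℝ) := by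
      push_cast
      rw [← hqb]
      ring
    rw [e, urot_add_int, urot_add]
  set u' : ℂ := u * (starRingEnd ℂ) (urot γ) with hu'
  have hu'1 : ‖u'‖ = 1 := by rw [hu', norm_mul, Complex.norm_conj, norm_urot, hu1, mul_one]
  obtain ⟨ℓ, hℓK, hℓ⟩ := exists_nat_urot_near hbβ hu'1 (by positivity : (0:ℝ) < d / 2) K
  have hkK : K ≤ b * ℓ := hℓK.trans (Nat.le_mul_of_pos_left ℓ (Nat.pos_of_ne_zero hb0))
  obtain ⟨ζ, hζF, hζ⟩ := hcon (b * ℓ) hkK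
  rw [hphase] at hζ
  have hnear : ‖urot (ℓ * ((b : ℝ) * β)) * urot γ - u‖ < d / 2 := by
    have hue : u' * urot γ = u := by
      rw [hu', mul_assoc, ← Complex.normSq_eq_conj_mul_self, Complex.normSq_eq_norm_sq, norm_urot]
      simp
    have e : urot (ℓ * ((b : ℝ) * β)) * urot γ - u = (urot (ℓ * ((b : ℝ) * β)) - u') * urot γ := by
      rw [← hue]; ring
    rw [e, norm_mul, norm_urot, mul_one]
    exact hℓ
  have : ‖u - ζ‖ < d := by
    have := norm_sub_le_norm_sub_add_norm_sub u (urot (ℓ * ((b : ℝ) * β)) * urot γ) ζ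
    rw [norm_sub_rev] at hnear
    linarith
  exact absurd (hdF ζ hζF) (not_le.2 this)

/-- **Phases of a non-resonant quadratic sequence do not accumulate at a finite set.**  If
`x ∉ ℚ` or `β ∉ ℚ`, then for every finite `F ⊆ ℂ` there is `ε > 0` with, for infinitely many `k ∈ ℕ`,
`dist(urot(xk² + βk + γ), F) ≥ ε`. [folklore] (new in this form) -/
theorem urot_quadratic_not_near_finset {x β : ℝ} (h : Irrational x ∨ Irrational β) (γ : ℝ)
    (F : Finset ℂ) : ∃ ε : ℝ, 0 < ε ∧ ∀ K : ℕ, ∃ k : ℕ, K ≤ k ∧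
      ∀ ζ ∈ F, ε ≤ ‖urot (x * (k : ℝ) ^ 2 + β * k + γ) - ζ‖ := by
  by_cases hx : Irrational x
  · exact urot_quadratic_not_near_finset_of_irrational hx β γ F
  · have hβ : Irrational β := h.resolve_left hx
    obtain ⟨q, rfl⟩ : ∃ q : ℚ, (q : ℝ) = x := by
      simpa [Irrational] using hx
    exact urot_quadratic_not_near_finset_of_rat q hβ γ F

end Summit.Schanuel.Schanuel.Theorems
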